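/-
Copyright (c) 2026. All rights reserved.
Released under Apache 2.0 license as described in the file LICENSE.
-/
import Literature.Computability.QuantumComplexity.GRLevelWordDesc
import Literature.Computability.QuantumComplexity.GRInsValsFP
import Literature.Computability.QuantumComplexity.GRTableMach
import Literature.Computability.QuantumComplexity.UniversalExecutor

/-!
# The Grover–Rudolph block word on codes with a UNARY level index (the usable form), and the cosine sampler's block

`GRLevelWordDesc.levelsA_codeFP_of`, `GRInsValsFP.insValsStd_codeFP_of` and `GRBlockWordFP.blockAN_codeFP_of` index the
levels by a BINARY-coded `j` (`pairE eσ natE`, the index of `UExec.flatMapRange`) and ask for the hypothesis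
`hN : CodeFP (pairE eσ natE) unE (fun q => q.2 + np q.1 + (v q.1 q.2).length)` — a UNARY output of length `≥ q.2` from an
input of length `O(|eσ q.1| + log q.2)`, which no polynomial-time function provides: those three lemmas are true but their
`hN` is unsatisfiable, so they cannot be instantiated.  This file states the USABLE forms: every level-indexed hypothesis is
over `pairE eσ unE` (the level index in unary — satisfiable, since `j < ℓ c` and `ℓ c` is unary in the context), and the
binary index of `flatMapRange` is recoded to the capped unary index `min j (ℓ c)` inside the proof
(`levelsA_codeFP_cap`, `GRData.insVals_codeFP_of`).  Then the cosine sampler's suffixes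
`GRCosineMach.v np j = 1ʲ 0 1^{j+np+1}` and their clean-block input lengths are put on codes (`suffix_codeFP_of`,
`suffixN_codeFP_of`) — exactly the `hv`, `hN` of the usable form.  (`GRBlockWordCosFP` then gives the cosine/table
machines' block word `GRStage.blockAN` on codes outright and the bridge to `GRTableMach.data`.)

HONEST FRAMING: the VALUE is a THEOREM (kernel-checked lemmas of a KNOWN reduction, Regev 2009) — NOT summit progress.
-/

noncomputable section

namespace Literature.Computability.QuantumComplexity

open _root_.Computability Cryptography Complexity Complexity.CodeFP SLP RevDesc AJLCore RevSim RevClean CleanPlaced Turing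

variable {σ : Type} {eσ : σ → List Bool}

namespace GRData

/-- **The gadget input values on codes, context-generic form**: from the level index in binary, the sizes in unary and
the clean block's input length `j + np + |v|` in unary. [cite: Regev2009, Lemma 3.14 (proof)] [folklore] -/
theorem insVals_codeFP_of (e : ℕ) (M : TM2ComputableAux Bool Bool) {j ℓ np kk : σ → ℕ} {v : σ → List Bool}
    (hj : CodeFP eσ natE j) (hℓ : CodeFP eσ unE ℓ) (hnp : CodeFP eσ unE np) (hk : CodeFP eσ unE kk)
    (hN : CodeFP eσ unE (fun c => j c + np c + (v c).length)) :
    CodeFP eσ (rawE natE) (fun c => j c :: (List.range (kk c)).map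
      (fun b => ℓ c + np c + (resW e M (j c + np c + (v c).length) b (CWrap.symTrue M) - (j c + np c)))) := by
  have hNN : CodeFP eσ natE (fun c => NN e M (j c + np c + (v c).length)) := ((NN_codeFP e M).comp hN :)
  have hL : CodeFP eσ natE (fun c => ℓ c + np c) := natAdd.comp ((BP.toNat hℓ).pair (BP.toNat hnp))
  have hn0 : CodeFP eσ natE (fun c => j c + np c) := natAdd.comp (hj.pair (BP.toNat hnp))
  have hg : CodeFP (pairE eσ natE) natE (fun t => ℓ t.1 + np t.1 +
      (NN e M (j t.1 + np t.1 + (v t.1).length) + (t.2 * A₁ M + (eA M (CWrap.symTrue M) : ℕ)) - (j t.1 + np t.1))) :=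
    (natAdd.comp ((hL.comp (fst _ _)).pair (natSub.comp ((natAdd.comp ((hNN.comp (fst _ _)).pair (natAdd.comp ((natMul.comp ((snd _ _).pair
      (const _ (A₁ M)))).pair (const _ (eA M (CWrap.symTrue M) : ℕ)))))).pair (hn0.comp (fst _ _))))) :)
  exact ((rawCons natE).comp (hj.pair ((map hg).comp ((CodeFP.id _).pair (urange.comp hk))))).congr fun _ => rfl

end GRData

namespace GRStage

variable {e : ℕ} {M : TM2ComputableAux Bool Bool}

/-- **The Grover–Rudolph block's word on codes, unary-indexed hypotheses** (the usable form of `levelsA_codeFP_of`):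
the level-indexed data are asked on codes of `(c, j)` with `j` in UNARY; the binary index of `flatMapRange` is capped at
`ℓ c` and recoded. [cite: Regev2009, Lemma 3.12 (proof), Lemma 3.14 (proof)] [cite: AroraBarak2009, §6.2 and proof of Thm. 6.15] -/
theorem levelsA_codeFP_cap {ℓ np base cr : σ → ℕ} {v : σ → ℕ → List Bool} {dpos : σ → ℕ → ℕ → ℕ} {t flag : σ → ℕ → ℕ}
    {gops : σ → ℕ → List (ClOp ℕ)} {had asreg hs : σ → List ℕ}
    (hℓ : CodeFP eσ unE ℓ) (hnp : CodeFP eσ natE np) (hbase : CodeFP eσ natE base) (hcr : CodeFP eσ natE cr)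
    (hv : CodeFP (pairE eσ unE) strE (fun q => v q.1 q.2))
    (hN : CodeFP (pairE eσ unE) unE (fun q => q.2 + np q.1 + (v q.1 q.2).length))
    (hdpos : CodeFP (pairE (pairE eσ unE) natE) natE (fun q => dpos q.1.1 q.1.2 q.2))
    (ht : CodeFP (pairE eσ unE) natE (fun q => t q.1 q.2)) (hflag : CodeFP (pairE eσ unE) natE (fun q => flag q.1 q.2))
    (hgops : CodeFP (pairE eσ unE) (rawE clopE) (fun q => gops q.1 q.2)) (hhad : CodeFP eσ (rawE natE) had)
    (hasreg : CodeFP eσ (rawE natE) asreg) (hhs : CodeFP eσ (rawE natE) hs) :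
    CodeFP eσ (rawE agE0) (fun c => (List.range (ℓ c)).flatMap fun j =>
      progA ((cleanOps e M (j + np c) (v c j)).map (ClOp.map (relabel (j + np c) (dpos c j) (base c)))) ++
        (oaaWordA (sandwichA (had c) (cr c) (t c j) (gops c j) [] [flag c j]) (reflectA (cr c) (asreg c) (hs c)) ++
          progA ((cleanOps e M (j + np c) (v c j)).map (ClOp.map (relabel (j + np c) (dpos c j) (base c)))).reverse)) := by
  have J : CodeFP (pairE eσ natE) unE (fun q => min q.2 (ℓ q.1)) := (unOfNatMin.comp ((hℓ.comp (fst _ _)).pair (snd _ _)) :)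
  have R : CodeFP (pairE eσ natE) (pairE eσ unE) (fun q => (q.1, min q.2 (ℓ q.1))) := (fst _ _).pair J
  have hn₀ : CodeFP (pairE eσ natE) natE (fun q => min q.2 (ℓ q.1) + np q.1) := natAdd.comp ((BP.toNat J).pair (hnp.comp (fst _ _)))
  have hv' : CodeFP (pairE eσ natE) strE (fun q => v q.1 (min q.2 (ℓ q.1))) := (hv.comp R :)
  have hN' : CodeFP (pairE eσ natE) unE (fun q => min q.2 (ℓ q.1) + np q.1 + (v q.1 (min q.2 (ℓ q.1))).length) := (hN.comp R :)
  have hdpos' : CodeFP (pairE (pairE eσ natE) natE) natE (fun q => dpos q.1.1 (min q.1.2 (ℓ q.1.1)) q.2) :=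
    (hdpos.comp ((R.comp (fst _ _)).pair (snd _ _)) :)
  have ht' : CodeFP (pairE eσ natE) natE (fun q => t q.1 (min q.2 (ℓ q.1))) := (ht.comp R :)
  have hflag' : CodeFP (pairE eσ natE) natE (fun q => flag q.1 (min q.2 (ℓ q.1))) := (hflag.comp R :)
  have hgops' : CodeFP (pairE eσ natE) (rawE clopE) (fun q => gops q.1 (min q.2 (ℓ q.1))) := (hgops.comp R :)
  have hP := CleanXor.placedWordA_codeFP_of (e := e) (M := M) (σ := σ × ℕ) (n₀ := fun q => min q.2 (ℓ q.1) + np q.1)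
    (v := fun q => v q.1 (min q.2 (ℓ q.1))) (dpos := fun q i => dpos q.1 (min q.2 (ℓ q.1)) i) (base := fun q => base q.1)
    hn₀ hv' hN' (hbase.comp (fst _ _)) hdpos'
  have hR := CleanXor.placedRevWordA_codeFP_of (e := e) (M := M) (σ := σ × ℕ) (n₀ := fun q => min q.2 (ℓ q.1) + np q.1)
    (v := fun q => v q.1 (min q.2 (ℓ q.1))) (dpos := fun q i => dpos q.1 (min q.2 (ℓ q.1)) i) (base := fun q => base q.1)
    hn₀ hv' hN' (hbase.comp (fst _ _)) hdpos'
  have hW := rotWordA_codeFP_of (t := fun c j => t c (min j (ℓ c))) (flag := fun c j => flag c (min j (ℓ c)))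
    (gops := fun c j => gops c (min j (ℓ c))) hcr ht' hflag' hgops' hhad hasreg hhs
  have H : CodeFP eσ (rawE agE0) (fun c => (List.range (ℓ c)).flatMap fun j =>
      progA ((cleanOps e M (min j (ℓ c) + np c) (v c (min j (ℓ c)))).map
          (ClOp.map (relabel (min j (ℓ c) + np c) (dpos c (min j (ℓ c))) (base c)))) ++
        (oaaWordA (sandwichA (had c) (cr c) (t c (min j (ℓ c))) (gops c (min j (ℓ c))) [] [flag c (min j (ℓ c))])
            (reflectA (cr c) (asreg c) (hs c)) ++
          progA ((cleanOps e M (min j (ℓ c) + np c) (v c (min j (ℓ c)))).map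
            (ClOp.map (relabel (min j (ℓ c) + np c) (dpos c (min j (ℓ c))) (base c)))).reverse)) :=
    UExec.flatMapRange hℓ (agAppend hP (agAppend hW hR))
  exact H.congr fun c => List.flatMap_congr fun j hj => by rw [Nat.min_eq_left (List.mem_range.1 hj).le]

/-! ### The cosine sampler's suffixes on codes, and its block word -/

/-- **The cosine machine's suffix `1ʲ 0 1^{j+np+1}` on codes** of `(c, j)`, `j` in unary. [folklore] -/
theorem suffix_codeFP_of {np : σ → ℕ} (hnp : CodeFP eσ unE np) :
    CodeFP (pairE eσ unE) strE (fun q => GRCosineMach.v (np q.1) q.2) := by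
  have hU : CodeFP unE strE (fun n => unE n) := recodeOut (CodeFP.id unE) fun _ => rfl
  have hO : CodeFP unE strE ones := recodeOut (CodeFP.id unE) fun n => unE_eq_ones n
  exact (strAppend.comp ((hU.comp (snd _ _)).pair (strAppend.comp ((const _ ([false] : List Bool)).pair (hO.comp (unSucc.comp
    (BP.uadd (snd _ _) (hnp.comp (fst _ _))))))))).congr fun _ => rfl

/-- **The cosine machine's clean-block input length `j + np + |1ʲ 0 1^{j+np+1}|` on codes**, in unary. [folklore] -/
theorem suffixN_codeFP_of {np : σ → ℕ} (hnp : CodeFP eσ unE np) :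
    CodeFP (pairE eσ unE) unE (fun q => q.2 + np q.1 + (GRCosineMach.v (np q.1) q.2).length) :=
  (BP.uadd (BP.uadd (snd _ _) (hnp.comp (fst _ _))) (BP.uadd (snd _ _) (unSucc.comp (unSucc.comp (BP.uadd (snd _ _)
    (hnp.comp (fst _ _))))))).congr fun q => by
    show q.2 + np q.1 + (q.2 + (q.2 + np q.1 + 1 + 1)) = _
    have := GRCosineMach.length_v (np q.1) q.2
    omega

end GRStage

end Literature.Computability.QuantumComplexity

end
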